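import Mathlib
import Summits.HodgeConjecture.HodgeConjecture.Theses.SparseFermatTropicalDeficiency

/-!
# Birth skeleton (BC3) for the crux `TropicalCycleDeficiency` of route `SparseFermatTropicalDeficiency`

Crux (route decl, fixed; item stmt-HodgeConjecture-18618): there is a PURE sparse Fermat datum `𝔇`
and a generic `M_S`-unimodular height `h` such that for every finite polyhedral structure `Q` on the
extended tropical hypersurface `X̄_h ⊂ 𝕋ℙ^{2p+1}` and every family of `Q`-adapted real tropical
`p`-cycles, the `ℝ`-span of their classes in cellular tropical homology `H_{p,p}(X̄_h, Q; ℝ)` has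
dimension `< m(𝔇) = invariantRank 𝔇`.

Line (the route's own two-layer plan K1a/K1b/K1c, re-cut along the one interface the tree types —
the DIMENSION of `H_{p,p}` — instead of the untyped "canonical structure / subordinate cycle"):
* `inst` — the intended instance `𝔇₁ = (3, 8, B₁)`: octic sixfolds `Σ xᵢ⁸ + Σ_{b ∈ B₁} c_b x^b = 0`
  in `ℙ⁷`, `B₁` = the 10 non-diagonal degree-8 monomials whose residue mod 8 lies in the character
  lattice `Λ ⊂ (ℤ/8)⁸` (`|Λ| = 256`) generated by the residues of
  `x₁x₂x₄x₅⁴x₇, x₁x₂x₃⁴x₄x₇, x₁²x₂²x₄²x₆², x₀²x₁²x₂⁴`; explicitly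
  `B₁ = {x₆²x₇⁶, x₆⁴x₇⁴, x₆⁶x₇², x₃⁴x₅⁴, x₁x₂x₄x₅⁴x₇, x₁x₂x₃⁴x₄x₇, x₁²x₂²x₄²x₇², x₁²x₂²x₄²x₆²,
  x₀²x₁²x₂⁴, x₀⁴x₁⁴}`; `S = {8eᵢ} ∪ B₁` is then ALL 18 points of `8Δ₇` in the affine lattice
  `8e₀ + M_S`, `[M₀ : M_S] = 8192`, normalised `M_S`-volume of `8Δ₇` = 256; `Λ_{B₁} = Λ` has exactly
  8 admissible characters, all Hodge (`2|tα| = 64` for `t = 1,3,5,7`), so `m(𝔇₁) = 9` and `𝔇₁` is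
  pure (checked by enumeration in the registering seat; to be PROVED in `stub_instancePure`).
* `stub_instancePure : inst.IsPure` (K1a, character half — Shioda's finite check over `Λ`).
* `stub_genericUnimodularHeight : ∃ h, inst.IsGenericHeight h ∧ inst.IsUnimodularHeight h` (K1a,
  polyhedral half — a regular triangulation of the 18-point configuration `S` unimodular for `M_S`
  exists (256 maximal simplices); its open secondary chamber then contains heights with
  `1, (h_b)_b` linearly independent over `ℚ`. TOPCOM/polymake-size certificate; the BC5 plan-only rung).
* `stub_homologyRankBound : HomologyRankBound inst` — at every generic unimodular height and for
  every polyhedral structure `Q` of `X̄_h`, `H_{3,3}(X̄_h, Q; ℝ)` is finite-dimensional of dimension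
  `≤ m(𝔇₁)` (cellular tropical homology is independent of `Q`, Mikhalkin–Zharkov Prop. 2.2, and the
  orbifold form of the Itenberg–Katzarkov–Mikhalkin–Zharkov comparison bounds `dim H_{p,p}(X̄_h)` by
  `h^{p,p}` of the `A_B`-invariant cohomology of the nearby fibre, `≤ dim H^{2p}(X_c)^{A_B} = m`).
* `stub_nonRealisableClass : NonRealisableClass inst` — THE HEART (K1b + K1c): at every generic
  unimodular height, for every structure `Q` and every family of `Q`-adapted tropical 3-cycles there
  is a class of `H_{3,3}(X̄_h, Q; ℝ)` outside their span — failure of the tropical Hodge conjecture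
  (Amini–Piquerez, arXiv:2012.13142, Conj. 1.2) on the `(3,3)`-row of `X̄_h`, where the tropical
  monodromy vanishes by purity, at irrational generic heights (their Thm. 1.1 settles every
  RATIONALLY triangulable case the other way, so nothing less than genericity can work).
Composition (sorry-free, for EVERY datum): `TropicalCycleDeficiency_of_pieces 𝔇 : 𝔇.IsPure →
(∃ h generic unimodular) → HomologyRankBound 𝔇 → NonRealisableClass 𝔇 → TropicalCycleDeficiency`
(`finrank (span) < finrank H_{p,p} ≤ m` by `Submodule.finrank_lt`), and the skeleton theorem
`TropicalCycleDeficiency_of : TropicalCycleDeficiency` (route decl BY NAME) discharging the four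
hypotheses at `𝔇 := inst` with the declared stubs — the only `sorry`s of the file. If the instance
gate fails for `𝔇₁` (no unimodular chamber), the same composition re-instantiates at another pure
datum.
-/

noncomputable section

namespace Summit.HodgeConjecture.HodgeConjecture.Cruxes.TropicalCycleDeficiency.Birth

open scoped BigOperators Classical
open Literature.AlgebraicGeometry.Tropical Literature.AlgebraicGeometry.HodgeTheory
open Literature.AlgebraicGeometry.HodgeTheory.SparseFermat

/-! ### The instance `𝔇₁ = (3, 8, B₁)` -/

/-- The residues mod 8 of the four seed monomials `x₁x₂x₄x₅⁴x₇, x₁x₂x₃⁴x₄x₇, x₁²x₂²x₄²x₆²,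
x₀²x₁²x₂⁴` (they generate the character lattice `Λ`, `|Λ| = 256`). -/
def seedResidues : Set (Fin (2 * 3 + 2) → ZMod 8) :=
  {![0, 1, 1, 0, 1, 4, 0, 1], ![0, 1, 1, 4, 1, 0, 0, 1], ![0, 2, 2, 0, 2, 0, 2, 0],
    ![2, 2, 4, 0, 0, 0, 0, 0]}

/-- The character lattice `Λ ⊂ (ℤ/8)⁸` generated by the seed residues (the characters of `μ₈⁸`
trivial on the symmetry group `A_B`). -/
def seedLattice : AddSubgroup (Fin (2 * 3 + 2) → ZMod 8) :=
  AddSubgroup.closure seedResidues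

/-- `B₁`: all degree-8 monomials in `x₀, …, x₇` with at least two variables whose residue mod 8 lies
in `Λ` (= all `A_B`-invariant non-diagonal degree-8 monomials; 10 of them, listed in the module
docstring). -/
def octicMonomials : Finset (Fin (2 * 3 + 2) →₀ ℕ) :=
  ((Finset.Nat.antidiagonalTuple (2 * 3 + 2) 8).map
      Finsupp.equivFunOnFinite.symm.toEmbedding).filter
    fun b ↦ 2 ≤ b.support.card ∧ (fun i ↦ ((b i : ℕ) : ZMod 8)) ∈ seedLattice

/-- Members of `B₁` have degree 8. -/
theorem degree_of_mem_octicMonomials {b : Fin (2 * 3 + 2) →₀ ℕ} (hb : b ∈ octicMonomials) :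
    (∑ i, b i) = 8 := by
  simp only [octicMonomials, Finset.mem_filter, Finset.mem_map] at hb
  obtain ⟨⟨a, ha, rfl⟩, -, -⟩ := hb
  rw [Finset.Nat.mem_antidiagonalTuple] at ha
  simpa using ha

/-- Members of `B₁` involve at least two variables. -/
theorem two_le_card_support_of_mem_octicMonomials {b : Fin (2 * 3 + 2) →₀ ℕ}
    (hb : b ∈ octicMonomials) : 2 ≤ b.support.card := by
  simp only [octicMonomials, Finset.mem_filter] at hb
  exact hb.2.1

/-- The intended instance `𝔇₁ = (p, d, B) = (3, 8, B₁)`: the sparse octic sixfold family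
`Σᵢ xᵢ⁸ + Σ_{b ∈ B₁} c_b x^b = 0` in `ℙ⁷` (`m(𝔇₁) = 9`, pure). -/
def inst : Datum where
  p := 3
  d := 8
  B := octicMonomials
  two_le_p := by norm_num
  three_le_d := by norm_num
  degree_eq := fun _ hb ↦ degree_of_mem_octicMonomials hb
  two_le_card_support := fun _ hb ↦ two_le_card_support_of_mem_octicMonomials hb

/-! ### Stub statements (named `Prop`s, parametrised by the datum) -/

/-- (L) COMPARISON BOUND: at every generic unimodular height `h` and for every polyhedral structure
`Q` of `X̄_h`, the cellular tropical homology `H_{p,p}(X̄_h, Q; ℝ)` is finite-dimensional of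
dimension at most `m(𝔇) = invariantRank 𝔇` (structure-independence of cellular tropical homology +
the orbifold IKMZ comparison `dim H_{p,p}(X̄_h) = h^{p,p}(H^{2p}(X_c)^{A_B}) ≤ m`). -/
def HomologyRankBound (𝔇 : Datum) : Prop :=
  ∀ h : ↥𝔇.B → ℝ, 𝔇.IsGenericHeight h → 𝔇.IsUnimodularHeight h →
    ∀ Q : Finset (TropCell (2 * 𝔇.p + 2)), IsStructureOf Q (𝔇.tropicalVariety h) →
      Module.Finite ℝ (tropHomology Q 𝔇.p 𝔇.p) ∧
        Module.finrank ℝ (tropHomology Q 𝔇.p 𝔇.p) ≤ 𝔇.invariantRank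

/-- (XL — the load-bearing statement) NON-REALISABLE CLASS: at every generic unimodular height `h`,
for every polyhedral structure `Q` of `X̄_h` and every family of `Q`-adapted real tropical
`p`-cycles, some class of `H_{p,p}(X̄_h, Q; ℝ)` lies outside the `ℝ`-span of their classes — the
tropical Hodge conjecture FAILS for `X̄_h` on the `(p,p)`-row at generic heights. -/
def NonRealisableClass (𝔇 : Datum) : Prop :=
  ∀ h : ↥𝔇.B → ℝ, 𝔇.IsGenericHeight h → 𝔇.IsUnimodularHeight h →
    ∀ Q : Finset (TropCell (2 * 𝔇.p + 2)), IsStructureOf Q (𝔇.tropicalVariety h) →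
      ∀ (κ : Type) (C : κ → TropCycle Q 𝔇.p),
        ∃ γ : tropHomology Q 𝔇.p 𝔇.p, γ ∉ Submodule.span ℝ (Set.range fun k ↦ (C k).cls)

/-! ### Stubs (the ONLY `sorry`s of the file) -/

/-- Stub 1 (M, K1a — characters): `𝔇₁` is pure: every admissible character of `μ₈⁸` in `Λ` is a
Hodge character (8 admissible characters in `Λ`, `2|tα| = 64` for all units `t`).
[cite: Shioda1979PJA, §1 eq. (2) and §4] [cite: Shioda1979HodgeFermat, Thm. I] -/
theorem stub_instancePure : inst.IsPure := by
  sorry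

/-- Stub 2 (L, K1a — polyhedral; the BC5 plan-only rung): the 18-point configuration
`S = {8eᵢ} ∪ B₁` has a regular triangulation unimodular for `M_S = ℤ⟨S - S⟩` (256 maximal
simplices), and its open secondary chamber contains a height with `1, (h_b)_b` linearly independent
over `ℚ`. [cite: MaclaganSturmfels2015, §2.3 and §4.5] -/
theorem stub_genericUnimodularHeight :
    ∃ h : ↥inst.B → ℝ, inst.IsGenericHeight h ∧ inst.IsUnimodularHeight h := by
  sorry

/-- Stub 3 (L): the comparison bound `dim H_{3,3}(X̄_h, Q; ℝ) ≤ m(𝔇₁)` (with finiteness) at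
generic unimodular heights of `𝔇₁`. [cite: MikhalkinZharkov2014Eigenwave, §2.2 and Prop. 2.2]
[cite: AminiPiquerez2020TropicalHC, §1.1] -/
theorem stub_homologyRankBound : HomologyRankBound inst := by
  sorry

/-- Stub 4 (XL, hardest — the arithmetic heart K1b/K1c): a non-realisable `(3,3)`-class on `X̄_h`
at every generic unimodular height of `𝔇₁`, for every structure and every family of tropical
3-cycles. [cite: AminiPiquerez2020TropicalHC, Conj. 1.2 (negated instance) and Thm. 1.1]
[cite: MikhalkinZharkov2014Eigenwave, §6] -/
theorem stub_nonRealisableClass : NonRealisableClass inst := by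
  sorry

/-! ### Composition (sorry-free) -/

/-- The implication content, sorry-free and for EVERY datum: purity + a generic unimodular height +
the comparison bound + a non-realisable class give the crux statement VERBATIM
(`finrank (span of the classes) < finrank H_{p,p}(X̄_h, Q) ≤ m(𝔇)`). -/
theorem TropicalCycleDeficiency_of_pieces (𝔇 : Datum) (h₁ : 𝔇.IsPure)
    (h₂ : ∃ h : ↥𝔇.B → ℝ, 𝔇.IsGenericHeight h ∧ 𝔇.IsUnimodularHeight h)
    (h₃ : HomologyRankBound 𝔇) (h₄ : NonRealisableClass 𝔇) :
    Summit.HodgeConjecture.HodgeConjecture.Theses.SparseFermatTropicalDeficiency.TropicalCycleDeficiency := by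
  obtain ⟨h, hgen, huni⟩ := h₂
  refine ⟨𝔇, h₁, h, hgen, huni, fun Q hQ κ C ↦ ?_⟩
  obtain ⟨hfin, hle⟩ := h₃ h hgen huni Q hQ
  obtain ⟨γ, hγ⟩ := h₄ h hgen huni Q hQ κ C
  haveI := hfin
  have hne : Submodule.span ℝ (Set.range fun k ↦ (C k).cls) ≠ ⊤ :=
    fun htop ↦ hγ (htop ▸ Submodule.mem_top)
  exact (Submodule.finrank_lt hne).trans_le hle

/-- **THE SKELETON THEOREM.** The crux
`Summit.HodgeConjecture.HodgeConjecture.Theses.SparseFermatTropicalDeficiency.TropicalCycleDeficiency`,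
concluded BY NAME from the four DECLARED stubs (the only `sorry`s of the file) through the
sorry-free composition `TropicalCycleDeficiency_of_pieces` at the instance `𝔇₁`.
[cite: AminiPiquerez2020TropicalHC, Conj. 1.2] -/
theorem TropicalCycleDeficiency_of :
    Summit.HodgeConjecture.HodgeConjecture.Theses.SparseFermatTropicalDeficiency.TropicalCycleDeficiency :=
  TropicalCycleDeficiency_of_pieces inst stub_instancePure stub_genericUnimodularHeight
    stub_homologyRankBound stub_nonRealisableClass

end Summit.HodgeConjecture.HodgeConjecture.Cruxes.TropicalCycleDeficiency.Birth

end
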